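import Summits.QuantumFields.YangMills.Theorems.LuscherReductionTwistedTraceScalingBTColourFP
import HarnessLib

/-!
# (B-ST) step (F)/(L-6), the MATCHING IDENTITY: at the vacuum slow datum the Born–Oppenheimer kernel of the FULLY gauge-averaged transfer kernel equals the BASED-averaged fibre form
# (lane A of S-BASE, crux `TwistedTraceScaling` stmt-QuantumFields-20203, C4-CORE, the (B-ST) pen; HANDOFF-g21 UPDATE 20:14Z (W1-5) = (L-6); cdisprove UPDATE 23 (2))

Lane A's fibre block works with the BASED-averaged central kernel `G₁(x,x') = ∫_h K_β(orthoTube 1 x, (orthoTube 1 x')^{basedExt h}) dh` (`M` of `…BOStiffSlowAssembly.form_le_of_product_near`),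
while the record currency is tied (R65 ✓`…Negative.RecordCurrencyNoSlack`, ✓`…BOStiffCurrencyCut`) to the Born–Oppenheimer kernel `𝒦_β(1,1) = boKernel β Ω 1 1` of the FULLY averaged
kernel `K̃_β`.  For a colour-blind profile the two fibre forms COINCIDE — there is no normalisation factor to match:
★★★ `boKernel_one_one_eq_based` — for bounded measurable `Ω` with `Ω ∘ Ad_g = Ω`:
  `boKernel β Ω 1 1 = ∫ Ω(v̂)·(∫ (∫_h K_β(orthoTube 1 v, (orthoTube 1 v')^{basedExt h}) dh)·Ω(v̂') dπ(v')) dπ(v)`.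
Proof: `K̃ = ∫_c ∫_h K(·, c·(·)^{bE h}·c⁻¹)` (✓`…AvgKernelColourBased.avgKernel_eq_colour_based`), `K_β(U, cWc⁻¹) = K_β(c⁻¹Uc, W)` (✓`transferKernel_conj_right_eq`), a constant conjugation of
`orthoTube 1 v` is `orthoTube 1 (Ad v)` on the cap (R33 ✓`gaugeTransform_const_orthoTube`, ✓`gaugeTransform_const_oneSite_one`), two bounded Fubini swaps, and the `Ad`-invariance of
`π` (✓`integral_orthoTransverse_colourRotate`) and of `Ω` — the pattern of ✓`…BTColourFP.boKernel_fp` with the based slice in place of the FP weight.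
HONEST FRAMING: an exact symmetry identity (Fubini + invariance of Haar) for a stub of a child of the CONDITIONAL route R2b1; (B-ST) OPEN; C4-CORE OPEN; not a gap, not Clay.
-/

set_option autoImplicit false

noncomputable section

open MeasureTheory Filter Topology Real
open scoped BigOperators
open Literature.MathematicalPhysics.QuantumFieldTheory
open Literature.MathematicalPhysics.QuantumLattice

namespace Summit.QuantumFields.YangMills.Theorems.FemtoTransferGap.TwoLattice.ConstTube

open Summit.QuantumFields.YangMills.Theorems.FemtoTransferGap
open Summit.QuantumFields.YangMills.Theorems.FemtoTransferGap.TwoLattice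
open Summit.QuantumFields.YangMills.Theorems.FemtoTransferGap.TwoLattice.Avg
open Summit.QuantumFields.YangMills.Theorems.FemtoTransferGap.TwoLattice.Stiff (LinkSpace)

variable {L : ℕ} [NeZero L]

/-- The three-variable integrand `((v,v'),c,h) ↦ K_β(c⁻¹(orthoTube 1 v)c, (orthoTube 1 v')^{basedExt h})` is jointly measurable. [folklore] -/
theorem measurable_based_integrand (β : ℝ) :
    Measurable fun q : (((Edge 3 L → Fin 3 → ℝ) × (Edge 3 L → Fin 3 → ℝ)) × SU2) × (NzSite L → SU2) =>
      transferKernel su2Rep β (gaugeTransform (fun _ : Site 3 L => q.1.2⁻¹) (orthoTube L 1 q.1.1.1)) (gaugeTransform (basedExt L q.2) (orthoTube L 1 q.1.1.2)) := by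
  have h := measurable_fp_integrand (L := L) β (W := fun _ => (1 : ℝ)) measurable_const 1 1
  have hc : Measurable fun q : (((Edge 3 L → Fin 3 → ℝ) × (Edge 3 L → Fin 3 → ℝ)) × SU2) × (NzSite L → SU2) =>
      ((q.1, basedExt L q.2) : (((Edge 3 L → Fin 3 → ℝ) × (Edge 3 L → Fin 3 → ℝ)) × SU2) × (Site 3 L → SU2)) :=
    measurable_fst.prodMk ((measurable_basedExt L).comp measurable_snd)
  have h2 := h.comp hc
  simpa only [Function.comp_def, one_mul] using h2

/-- The based kernel `(w, v') ↦ ∫_h K_β(c⁻¹(orthoTube 1 w)c, (orthoTube 1 v')^{basedExt h}) dh` is jointly measurable in `((w,v'),c)` and bounded by the kernel bound. [folklore] -/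
theorem measurable_basedKernel_fibre (β : ℝ) :
    Measurable fun t : ((Edge 3 L → Fin 3 → ℝ) × (Edge 3 L → Fin 3 → ℝ)) × SU2 =>
      ∫ h, transferKernel su2Rep β (gaugeTransform (fun _ : Site 3 L => t.2⁻¹) (orthoTube L 1 t.1.1)) (gaugeTransform (basedExt L h) (orthoTube L 1 t.1.2)) ∂basedMeasure L := by
  haveI : IsProbabilityMeasure (basedMeasure L) := by unfold basedMeasure; infer_instance
  have h := ((measurable_based_integrand (L := L) β).stronglyMeasurable.integral_prod_right' (ν := basedMeasure L)).measurable
  simpa only using h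

set_option maxHeartbeats 1600000 in
-- three nested Fubini swaps with explicit integrability witnesses.
/-- ★★★ **THE BASED/FULL MATCHING IDENTITY AT THE VACUUM SLOW DATUM** (see the module docstring). [cite: Luscher1983, §3] [cite: SeilerLNP1982, §3] -/
theorem boKernel_one_one_eq_based (β : ℝ) {Ω : LinkSpace L → ℝ} (hΩm : Measurable Ω) {CΩ : ℝ} (hCΩ : ∀ x, |Ω x| ≤ CΩ)
    (hΩinv : ∀ (g : SU2) (x : LinkSpace L), Ω (adL L g x) = Ω x) :
    boKernel L β Ω 1 1 =
      ∫ v, Ω (linkEmbed L v) * (∫ v', (∫ h, transferKernel su2Rep β (orthoTube L 1 v) (gaugeTransform (basedExt L h) (orthoTube L 1 v')) ∂basedMeasure L) * Ω (linkEmbed L v')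
        ∂orthoTransverse L) ∂orthoTransverse L := by
  haveI := isFiniteMeasure_orthoTransverse L
  haveI : SecondCountableTopology SU2 := secondCountableTopology_su2
  haveI : IsProbabilityMeasure (basedMeasure L) := by unfold basedMeasure; infer_instance
  obtain ⟨M, hM⟩ := exists_transferKernel_le su2Rep continuous_su2Rep β (L := L)
  have hM0 : 0 ≤ M := (transferKernel_pos su2Rep β (1 : GaugeConfig 3 L SU2) 1).le.trans (hM 1 1)
  have hCΩ0 : 0 ≤ CΩ := (abs_nonneg _).trans (hCΩ 0)
  set P : ℝ := (orthoTransverse L).real Set.univ with hP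
  -- the based `h`-integral with the left point conjugated by `c⁻¹`: `G((v,v'),c) = ∫_h K(c⁻¹(oT 1 v)c, (oT 1 v')^{bE h}) dh`
  set G : ((Edge 3 L → Fin 3 → ℝ) × (Edge 3 L → Fin 3 → ℝ)) × SU2 → ℝ := fun t =>
    ∫ h, transferKernel su2Rep β (gaugeTransform (fun _ : Site 3 L => t.2⁻¹) (orthoTube L 1 t.1.1)) (gaugeTransform (basedExt L h) (orthoTube L 1 t.1.2)) ∂basedMeasure L with hG
  have hGm : Measurable G := by rw [hG]; exact measurable_basedKernel_fibre (L := L) β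
  have hGb : ∀ t, |G t| ≤ M := fun t => by
    rw [hG]; dsimp only
    calc |∫ h, transferKernel su2Rep β (gaugeTransform (fun _ : Site 3 L => t.2⁻¹) (orthoTube L 1 t.1.1)) (gaugeTransform (basedExt L h) (orthoTube L 1 t.1.2)) ∂basedMeasure L|
        ≤ ∫ h, |transferKernel su2Rep β (gaugeTransform (fun _ : Site 3 L => t.2⁻¹) (orthoTube L 1 t.1.1)) (gaugeTransform (basedExt L h) (orthoTube L 1 t.1.2))| ∂basedMeasure L :=
          abs_integral_le_integral_abs
      _ ≤ ∫ _h, M ∂basedMeasure L :=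
          integral_mono_of_nonneg (ae_of_all _ fun _ => abs_nonneg _) (integrable_const _) (ae_of_all _ fun h => by
            show |transferKernel su2Rep β _ _| ≤ M
            rw [abs_of_pos (transferKernel_pos su2Rep β _ _)]; exact hM _ _)
      _ = M := by simp
  -- Step 1: the averaged kernel as `∫_c G((v,v'),c) dc`
  have havg : ∀ v v' : Edge 3 L → Fin 3 → ℝ, avgKernel β (orthoTube L 1 v) (orthoTube L 1 v') = ∫ c, G ((v, v'), c) ∂haarProbability SU2 := fun v v' => by
    rw [avgKernel_eq_colour_based, hG]
    refine integral_congr_ae (ae_of_all _ fun c => ?_)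
    dsimp only
    refine integral_congr_ae (ae_of_all _ fun h => ?_)
    dsimp only
    exact transferKernel_conj_right_eq β c _ _
  have hstep1 : boKernel L β Ω 1 1 =
      ∫ v, Ω (linkEmbed L v) * ∫ v', (∫ c, G ((v, v'), c) ∂haarProbability SU2) * Ω (linkEmbed L v') ∂orthoTransverse L ∂orthoTransverse L := by
    unfold boKernel
    refine integral_congr_ae (ae_of_all _ fun v => ?_)
    dsimp only
    congr 1
    refine integral_congr_ae (ae_of_all _ fun v' => ?_)
    dsimp only
    rw [havg]
  -- Step 2: swap `v' ↔ c` (for each `v`) and `v ↔ c`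
  have hF3m : Measurable fun q : ((Edge 3 L → Fin 3 → ℝ) × (Edge 3 L → Fin 3 → ℝ)) × SU2 => G q * Ω (linkEmbed L q.1.2) :=
    hGm.mul (hΩm.comp ((measurable_linkEmbed L).comp (measurable_snd.comp measurable_fst)))
  have hswap1 : ∀ v : Edge 3 L → Fin 3 → ℝ,
      ∫ v', (∫ c, G ((v, v'), c) ∂haarProbability SU2) * Ω (linkEmbed L v') ∂orthoTransverse L =
        ∫ c, ∫ v', G ((v, v'), c) * Ω (linkEmbed L v') ∂orthoTransverse L ∂haarProbability SU2 := fun v => by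
    have hm : Measurable fun p : (Edge 3 L → Fin 3 → ℝ) × SU2 => G ((v, p.1), p.2) * Ω (linkEmbed L p.1) := by
      have hp : Measurable fun p : (Edge 3 L → Fin 3 → ℝ) × SU2 => (((v, p.1), p.2) : ((Edge 3 L → Fin 3 → ℝ) × (Edge 3 L → Fin 3 → ℝ)) × SU2) :=
        ((measurable_const.prodMk measurable_fst).prodMk measurable_snd)
      have h := hF3m.comp hp
      simpa only [Function.comp_def] using h
    have hint : Integrable (fun p : (Edge 3 L → Fin 3 → ℝ) × SU2 => G ((v, p.1), p.2) * Ω (linkEmbed L p.1)) ((orthoTransverse L).prod (haarProbability SU2)) :=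
      integrable_of_measurable_abs_le _ hm (C := M * CΩ) fun p => by
        rw [abs_mul]; exact mul_le_mul (hGb _) (hCΩ _) (abs_nonneg _) hM0
    have e : ∀ v', (∫ c, G ((v, v'), c) ∂haarProbability SU2) * Ω (linkEmbed L v') = ∫ c, G ((v, v'), c) * Ω (linkEmbed L v') ∂haarProbability SU2 := fun v' => by
      rw [← integral_mul_const]
    simp_rw [e]
    exact integral_integral_swap hint
  simp_rw [hswap1] at hstep1
  have hHm : Measurable fun p : (Edge 3 L → Fin 3 → ℝ) × SU2 => Ω (linkEmbed L p.1) * ∫ v', G ((p.1, v'), p.2) * Ω (linkEmbed L v') ∂orthoTransverse L := by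
    have hr : Measurable fun r : ((Edge 3 L → Fin 3 → ℝ) × SU2) × (Edge 3 L → Fin 3 → ℝ) => G ((r.1.1, r.2), r.1.2) * Ω (linkEmbed L r.2) := by
      have hp : Measurable fun r : ((Edge 3 L → Fin 3 → ℝ) × SU2) × (Edge 3 L → Fin 3 → ℝ) =>
          (((r.1.1, r.2), r.1.2) : ((Edge 3 L → Fin 3 → ℝ) × (Edge 3 L → Fin 3 → ℝ)) × SU2) :=
        ((measurable_fst.comp measurable_fst).prodMk measurable_snd).prodMk (measurable_snd.comp measurable_fst)
      have h := hF3m.comp hp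
      simpa only [Function.comp_def] using h
    have hI := (hr.stronglyMeasurable.integral_prod_right' (ν := orthoTransverse L)).measurable
    have hI' : Measurable fun p : (Edge 3 L → Fin 3 → ℝ) × SU2 => ∫ v', G ((p.1, v'), p.2) * Ω (linkEmbed L v') ∂orthoTransverse L := by
      simpa only using hI
    exact (hΩm.comp ((measurable_linkEmbed L).comp measurable_fst)).mul hI'
  have hHb : ∀ p : (Edge 3 L → Fin 3 → ℝ) × SU2, |Ω (linkEmbed L p.1) * ∫ v', G ((p.1, v'), p.2) * Ω (linkEmbed L v') ∂orthoTransverse L| ≤ CΩ * (M * CΩ * P) :=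
    fun p => by
      rw [abs_mul]
      refine mul_le_mul (hCΩ _) ?_ (abs_nonneg _) hCΩ0
      calc |∫ v', G ((p.1, v'), p.2) * Ω (linkEmbed L v') ∂orthoTransverse L| ≤ ∫ v', |G ((p.1, v'), p.2) * Ω (linkEmbed L v')| ∂orthoTransverse L :=
            abs_integral_le_integral_abs
        _ ≤ ∫ _v', M * CΩ ∂orthoTransverse L :=
            integral_mono_of_nonneg (ae_of_all _ fun _ => abs_nonneg _) (integrable_const _) (ae_of_all _ fun v' => by
              show |G ((p.1, v'), p.2) * Ω (linkEmbed L v')| ≤ M * CΩ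
              rw [abs_mul]; exact mul_le_mul (hGb _) (hCΩ _) (abs_nonneg _) hM0)
        _ = M * CΩ * P := by rw [integral_const, smul_eq_mul, hP]; ring
  have hswap2 : ∫ v, Ω (linkEmbed L v) * ∫ c, ∫ v', G ((v, v'), c) * Ω (linkEmbed L v') ∂orthoTransverse L ∂haarProbability SU2 ∂orthoTransverse L =
      ∫ c, ∫ v, Ω (linkEmbed L v) * ∫ v', G ((v, v'), c) * Ω (linkEmbed L v') ∂orthoTransverse L ∂orthoTransverse L ∂haarProbability SU2 := by
    have hint : Integrable (fun p : (Edge 3 L → Fin 3 → ℝ) × SU2 => Ω (linkEmbed L p.1) * ∫ v', G ((p.1, v'), p.2) * Ω (linkEmbed L v') ∂orthoTransverse L)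
        ((orthoTransverse L).prod (haarProbability SU2)) := integrable_of_measurable_abs_le _ hHm hHb
    have e : ∀ v, Ω (linkEmbed L v) * ∫ c, ∫ v', G ((v, v'), c) * Ω (linkEmbed L v') ∂orthoTransverse L ∂haarProbability SU2 =
        ∫ c, Ω (linkEmbed L v) * ∫ v', G ((v, v'), c) * Ω (linkEmbed L v') ∂orthoTransverse L ∂haarProbability SU2 := fun v => by rw [integral_const_mul]
    simp_rw [e]
    exact integral_integral_swap hint
  rw [hswap2] at hstep1
  -- Step 3: for each `c` the `v`-integral is the based fibre form, by the `Ad`-invariance of `π` and `Ω`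
  -- the based fibre form's `v`-integrand
  set Ψ : (Edge 3 L → Fin 3 → ℝ) → ℝ := fun w => Ω (linkEmbed L w) *
    ∫ v', (∫ h, transferKernel su2Rep β (orthoTube L 1 w) (gaugeTransform (basedExt L h) (orthoTube L 1 v')) ∂basedMeasure L) * Ω (linkEmbed L v') ∂orthoTransverse L with hΨ
  have hΨm : Measurable Ψ := by
    -- `G` at colour `1` is the based kernel with unconjugated left point
    have hsec : Measurable fun r : (Edge 3 L → Fin 3 → ℝ) × (Edge 3 L → Fin 3 → ℝ) =>
        (∫ h, transferKernel su2Rep β (gaugeTransform (fun _ : Site 3 L => (1 : SU2)⁻¹) (orthoTube L 1 r.1)) (gaugeTransform (basedExt L h) (orthoTube L 1 r.2)) ∂basedMeasure L) *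
          Ω (linkEmbed L r.2) := by
      have hp : Measurable fun r : (Edge 3 L → Fin 3 → ℝ) × (Edge 3 L → Fin 3 → ℝ) => ((r, (1 : SU2)) : ((Edge 3 L → Fin 3 → ℝ) × (Edge 3 L → Fin 3 → ℝ)) × SU2) :=
        measurable_id.prodMk measurable_const
      have h := hGm.comp hp
      have h' : Measurable fun r : (Edge 3 L → Fin 3 → ℝ) × (Edge 3 L → Fin 3 → ℝ) =>
          ∫ h, transferKernel su2Rep β (gaugeTransform (fun _ : Site 3 L => (1 : SU2)⁻¹) (orthoTube L 1 r.1)) (gaugeTransform (basedExt L h) (orthoTube L 1 r.2)) ∂basedMeasure L := by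
        rw [hG] at h; simpa only [Function.comp_def] using h
      exact h'.mul (hΩm.comp ((measurable_linkEmbed L).comp measurable_snd))
    have hone : ∀ U : GaugeConfig 3 L SU2, gaugeTransform (fun _ : Site 3 L => (1 : SU2)⁻¹) U = U := fun U => by
      rw [inv_one]; exact TT.gaugeTransform_one' U
    simp only [hone] at hsec
    have hI := (hsec.stronglyMeasurable.integral_prod_right' (ν := orthoTransverse L)).measurable
    have hI' : Measurable fun w : Edge 3 L → Fin 3 → ℝ =>
        ∫ v', (∫ h, transferKernel su2Rep β (orthoTube L 1 w) (gaugeTransform (basedExt L h) (orthoTube L 1 v')) ∂basedMeasure L) * Ω (linkEmbed L v') ∂orthoTransverse L := by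
      simpa only using hI
    rw [hΨ]
    exact (hΩm.comp (measurable_linkEmbed L)).mul hI'
  have hcap : ∀ᵐ v ∂orthoTransverse L, v ∈ capBalancedSet L := by
    rw [ae_iff]
    have h0 := orthoTransverse_compl_capBalancedSet L
    simpa only [Set.compl_def] using h0
  have hfibre : ∀ c : SU2, ∫ v, Ω (linkEmbed L v) * ∫ v', G ((v, v'), c) * Ω (linkEmbed L v') ∂orthoTransverse L ∂orthoTransverse L = ∫ v, Ψ v ∂orthoTransverse L := fun c => by
    have hpt : ∀ᵐ v ∂orthoTransverse L, Ω (linkEmbed L v) * ∫ v', G ((v, v'), c) * Ω (linkEmbed L v') ∂orthoTransverse L = Ψ (colourRotate L (fun _ => c⁻¹) v) := by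
      filter_upwards [hcap] with v hv
      rw [hΨ, hG]; dsimp only
      have hv1 : ∀ e : Edge 3 L, ∑ a, v e a ^ 2 ≤ 1 := sum_sq_le_one_of_cap L hv.2
      rw [linkEmbed_colourRotate_const, hΩinv]
      congr 1
      refine integral_congr_ae (ae_of_all _ fun v' => ?_)
      dsimp only
      rw [Summit.QuantumFields.YangMills.Theorems.TwistedTraceScaling.Negative.R33.gaugeTransform_const_orthoTube c⁻¹ 1 hv1,
        Summit.QuantumFields.YangMills.Theorems.TwistedTraceScaling.Negative.R33.gaugeTransform_const_oneSite_one]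
    rw [integral_congr_ae hpt, integral_orthoTransverse_colourRotate L (fun _ => c⁻¹) Ψ hΨm]
  rw [hstep1]
  simp_rw [hfibre]
  rw [integral_const, smul_eq_mul, probReal_univ, one_mul]

end Summit.QuantumFields.YangMills.Theorems.FemtoTransferGap.TwoLattice.ConstTube

end
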